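import Mathlib
import Summits.MatrixMultiplication.MatrixMultiplication.Theses.FidelityWitnesses
import Summits.MatrixMultiplication.MatrixMultiplication.Theorems.FidelityThesis.Negative.SummitEquivalence
import Literature.Computability.AlgebraicComplexity.TripartitionTensor
import Literature.Computability.AlgebraicComplexity.PrattTripartitionBounds
import Literature.Computability.AlgebraicComplexity.PrattTripartitionRank
import Literature.Computability.AlgebraicComplexity.TensorSemiringSpectrum
import Literature.Computability.AlgebraicComplexity.StrassenPreorderRank
import Literature.Computability.AlgebraicComplexity.AsymptoticSpectrumDuality
import Literature.Computability.AlgebraicComplexity.AsymptoticRankMatMul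
import Literature.Computability.AlgebraicComplexity.StrassenPreorderClosure
import Literature.Computability.AlgebraicComplexity.GroupAlgebraTensor
import Literature.Computability.AlgebraicComplexity.BorderRankRestriction
import Literature.RepresentationTheory.FiniteGroups.WedderburnBlocks

/-!
# Line `scc-dark-host` — crux `FidelityThesis` (stmt-MatrixMultiplication-4956), crux-strategist gen 1

THE SCC-DARK HOST SANDWICH.  A registered two-layer skeleton for the BC2-redirect decomposition of the restated
crux (`FidelityThesis ⟺ 2 < ω(ℂ)`, kernel-certified).  LAYER 1 — the two PIECES (route-level children of the crux):

* `X₁ = TripartitionDarkness` — LOWER piece, the crux ITEM stmt-MatrixMultiplication-18398 (not a stub here; DERIVED below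
  from LEAF 1a ∧ LEAF 1b, `tripartitionDarkness_of_leaves`, sorry-free): the asymptotic rank of Pratt's balanced
  tripartition tensor `T_k = tripartitionTensor ℂ k` (`dim = binom(3k,k) ≈ 6.75^k`) has rate `8`:
  `∀ ε ∈ (0,8), ∃ k₀, ∀ k ≥ k₀, (8−ε)^k < R̃(T_k)`.  Verbatim the conclusion of the tree's named fact
  `pratt2024_cor_1_11` (Set Cover Conjecture ⟹ this, Pratt 2024 Cor. 1.11), asked unconditionally = the first
  explicit counterexample family to the asymptotic rank conjecture.  Does not mention matrix multiplication; implies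
  neither `ω > 2` nor `ω = 2`.
* `X₂ = MatMulHostsTripartition` — UPPER piece (CONSTRUCTION), registered as `stub_matMulHostsTripartition` for a
  direct proof and ALSO derived from LEAF 2a ∧ LEAF 2b (`matMulHostsTripartition_of_leaves`, sorry-free):
  `∃ ε > 0`, eventually in `k`, some `n ≥ 1` with `n² ≤ (8−ε)^k` and `[T_k] ≲ [⟨n,n,n⟩]` in Strassen's asymptotic
  preorder on `TensorClass ℂ`: matrix multiplication hosts `T_k` strictly better than a unit tensor does (unit
  routing `T_k ≤ ⟨8^k/2⟩ ≤ ⟨n,n,n⟩`, `⌈3n²/4⌉ ≥ 8^k/2`, has rate exactly `8`).  Consistent with `ω = 2` and with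
  `ω > 2`; implies neither.

LAYER 2 — four LEAF stubs (registered): `stub_tkBorderRate` (border-rank darkness of `T_k` at the first power),
`stub_tkBorderTensorises` (the border rank of `T_k` tensorises up to rate), `stub_tripartitionGroupDesign` (a finite
group `G_k`, `|G_k| ≤ g^k`, `g < 8`, with `[T_k] ≲ [T_{ℂ[G_k]}]`), `stub_matMulDominatesDirectSums` (`⟨n,n,n⟩ ≳ ⊕ᵢ⟨dᵢ,dᵢ,dᵢ⟩`
when `dᵢ ≤ n`, `Σ dᵢ² ≤ n²` — a matrix-multiplication-only spectral fact, provable).  Registered stubs: these four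
and `stub_matMulHostsTripartition` (5 sorries, nothing else); BC3 probes `leaf → FidelityThesis`,
`leaf → MatrixMultiplication` fail 8/8 (folder `bc/leaves_probes.lean`).

COMPOSITION `FidelityThesis_of : X₁ → X₂ → FidelityThesis` — PROVED, no `sorry` outside the stubs; `crux_of_stubs`
concludes the crux from the four leaves, `crux_of_stubs'` from LEAF 1a ∧ 1b ∧ `stub_matMulHostsTripartition`
(`two_lt_omega_of_pieces`: at an odd `k` beyond both thresholds `A := (8−ε)^k ≤ (8−ε')^k < R̃(T_k) ≤ n^ω ≤
A^{ω/2}` with `A ≥ n² ≥ 1`, so `ω/2 > 1`; then `omega_le_two_of_not_fidelityThesis`).  The same proof is the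
split glue `fidelityThesis_of_subs` (planner file `FidelityWitnessesFidelityThesisSplit.lean`, rc 0) that a
prover lands under `Theorems/` once the route split is applied.

WHY THIS ANSWERS THE ROUND-2 OBJECTION (Lines/Sketch-dead.md: "exhibit a stub set proving FidelityThesis in
which no single stub implies `2 < ω(ℂ)`"): no piece and no leaf implies `2 < ω(ℂ)` or the summit — BC2 probes
`Xᵢ → MatrixMultiplication`, `Xᵢ → FidelityThesis` (`first | exact? | simpa | aesop`) FAIL for both pieces and all
four leaves (planner folder `bc/*.lean`, rc 1, unsolved goals), no landed theorem links any of them to `ω`, and each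
is consistent with `ω(ℂ) = 2` (darkness is about `T_k` alone; hosting is an upper-bound-type construction).
The cut is along an AUXILIARY OBJECT (`T_k`) with two open relations to `⟨n,n,n⟩`, not along a re-partition
of `ω > 2` (every such re-partition is `≥` the crux or does not amplify — the DRIFT obstruction of
STRATEGY-CENSUS.md §gen-1).

DOCUMENTATION THEOREMS (checked, sorry-free): `darkness_of_setCoverConjecture` (evidence: SCC ∧ Pratt Cor 1.11
⟹ X₁, both tree `Prop`s as hypotheses), `not_tkMinimal_of_darkness` (X₁ refutes crux `TkMinimal` of
route TripartitionBridge, stated against its verbatim text), `choose_le_asymptoticRank_Tk` (the proved floor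
`binom(3k,k) ≤ R̃(T_k)`), `rate_lt_rpow_of_pieces_at` (the QUANTITATIVE payoff: hosting rate `θ` with darkness gives
`ω ≥ 2·log 8 / log θ`, e.g. `θ = 27/4 ⟹ ω ≥ 2.178`).

Disproof used: honours `crux_false_without_rankBound` / `…growthBound` trivially (the line never touches the
fidelity inequality; it reaches the crux through `2 < ω`, `crux_of_two_lt_omega`); avoids the refuted
strengthenings (`not_fidelityThesisAt_of_gt`: no exponent is claimed beyond `ω − 2`; the certified exponent is
`2·log 8/log θ − 2 ≤ 0.178 < 0.37295`); no stub is an instance of a landed Negative lemma (none concerns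
`T_k` or hosting).
-/

set_option linter.dupNamespace false

namespace Summit.MatrixMultiplication.MatrixMultiplication.Cruxes.FidelityThesis.SccDarkHost

open Literature.Computability.AlgebraicComplexity
open Summit.MatrixMultiplication.MatrixMultiplication.Theses.FidelityWitnesses (FidelityThesis)
open Summit.MatrixMultiplication.MatrixMultiplication.Theorems (omega_le_two_of_not_fidelityThesis)

/-! ## The upper piece as a registered stub (the lower piece is the crux item stmt-MatrixMultiplication-18398) -/

/-- **STUB 2 (UPPER piece, CONSTRUCTION)**: matrix multiplication hosts `T_k` below rate `8`.  Mechanism on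
offer: a NONABELIAN group-algebra realisation `T_k ≤ ℂ[G_k]` (tripartition-TPP) with `|G_k|^{1/k} → g < 8`,
composed with `ℂ[G] ≲ ⟨n,n,n⟩`, `n² = |G|^{1+o(1)}` (spectral theorem on `TensorClass ℂ`); monomial
degenerations are support-capped at rate `≥ 9`, unit routing gives exactly `8`.  Size: XL / design problem.
[cite: Pratt2024SCC, §1.2] -/
theorem stub_matMulHostsTripartition :
    ∃ ε : ℝ, 0 < ε ∧ ∃ k₀ : ℕ, ∀ k : ℕ, k₀ ≤ k → ∃ n : ℕ, 1 ≤ n ∧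
      ((n : ℝ)) ^ 2 ≤ (8 - ε) ^ k ∧
      Literature.Computability.AlgebraicComplexity.AsympLe
        (fun x y : Literature.Computability.AlgebraicComplexity.TensorClass ℂ => x ≤ y)
        (Literature.Computability.AlgebraicComplexity.TensorClass.mk
          (Literature.Computability.AlgebraicComplexity.tripartitionTensor ℂ k))
        (Literature.Computability.AlgebraicComplexity.TensorClass.mk
          (Literature.Computability.AlgebraicComplexity.matMulTensor ℂ n n n)) := by
  sorry

/-! ## Hosting transfers asymptotic rank -/

/-- If `[T_k] ≲ [⟨n,n,n⟩]` in the asymptotic preorder on `TensorClass ℂ` (`n ≥ 1`) then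
`R̃(T_k) ≤ n^ω`: monotonicity of the abstract asymptotic rank under `≲`
(`asympRankOf_mono_of_asympLe`), `asympRankOf [t] = R̃(t)` and `R̃(⟨n,n,n⟩) = n^ω`. [folklore] -/
theorem asymptoticRank_le_of_hosting {k n : ℕ} (hn : 1 ≤ n)
    (h : AsympLe (fun x y : TensorClass ℂ => x ≤ y) (TensorClass.mk (tripartitionTensor ℂ k))
      (TensorClass.mk (matMulTensor ℂ n n n))) :
    asymptoticRank (tripartitionTensor ℂ k) ≤ (n : ℝ) ^ omega ℂ := by
  have hS := TensorClass.isStrassenPreorder ℂ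
  have m₀ : ∀ x y : TensorClass ℂ, x ≤ y →
      asympRankOf (fun x y : TensorClass ℂ => x ≤ y) x ≤
        asympRankOf (fun x y : TensorClass ℂ => x ≤ y) y :=
    fun x y hxy => hS.asympRankOf_mono hxy
  have key := hS.asympRankOf_mono_of_asympLe m₀ h
  rwa [TensorClass.asympRankOf_mk, TensorClass.asympRankOf_mk,
    asymptoticRank_matMulTensor ℂ n hn] at key

/-! ## The sandwich: darkness at `T_k` + cheap hosting of `T_k` force `ω(ℂ) > 2` -/

/-- **`TripartitionDarkness → MatMulHostsTripartition → 2 < ω(ℂ)`** (both hypotheses written out; they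
are the route's two child items of `FidelityThesis`).  Fix the hosting witness `ε > 0`; darkness at
`ε' := min ε 7 ∈ (0,8)`; take `k` odd beyond both thresholds; hosting at `k` gives `n ≥ 1` with
`1 ≤ n² ≤ A := (8−ε)^k`, so `8 − ε > 0` (odd power) and `A ≤ (8−ε')^k < R̃(T_k) ≤ n^ω ≤ A^{ω/2}`;
`A < A^{ω/2}` with `A ≥ 1` forces `ω/2 > 1`. [folklore] -/
theorem two_lt_omega_of_pieces
    (hdark : ∀ ε : ℝ, 0 < ε → ε < 8 → ∃ k₀ : ℕ, ∀ k : ℕ, k₀ ≤ k →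
      ((8 : ℝ) - ε) ^ k < Literature.Computability.AlgebraicComplexity.asymptoticRank
        (Literature.Computability.AlgebraicComplexity.tripartitionTensor ℂ k))
    (hhost : ∃ ε : ℝ, 0 < ε ∧ ∃ k₀ : ℕ, ∀ k : ℕ, k₀ ≤ k → ∃ n : ℕ, 1 ≤ n ∧
      ((n : ℝ)) ^ 2 ≤ (8 - ε) ^ k ∧
      Literature.Computability.AlgebraicComplexity.AsympLe
        (fun x y : Literature.Computability.AlgebraicComplexity.TensorClass ℂ => x ≤ y)
        (Literature.Computability.AlgebraicComplexity.TensorClass.mk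
          (Literature.Computability.AlgebraicComplexity.tripartitionTensor ℂ k))
        (Literature.Computability.AlgebraicComplexity.TensorClass.mk
          (Literature.Computability.AlgebraicComplexity.matMulTensor ℂ n n n))) :
    2 < omega ℂ := by
  obtain ⟨ε, hε, k₀, hk₀⟩ := hhost
  -- darkness in its meaningful range, at `ε' = min ε 7`
  set ε' : ℝ := min ε 7 with hε'
  have hε'pos : 0 < ε' := lt_min hε (by norm_num)
  have hε'lt : ε' < 8 := (min_le_right ε 7).trans_lt (by norm_num)
  have hε'le : ε' ≤ ε := min_le_left ε 7
  obtain ⟨k₁, hk₁⟩ := hdark ε' hε'pos hε'lt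
  -- an odd `k` beyond both thresholds
  set k : ℕ := 2 * max k₀ k₁ + 1 with hk
  have hkodd : Odd k := ⟨max k₀ k₁, by rw [hk]⟩
  have hk0 : k₀ ≤ k := by
    have := le_max_left k₀ k₁
    omega
  have hk1 : k₁ ≤ k := by
    have := le_max_right k₀ k₁
    omega
  obtain ⟨n, hn1, hn2, hle⟩ := hk₀ k hk0
  have hD := hk₁ k hk1
  -- `A := (8 - ε)^k ≥ n² ≥ 1`
  set A : ℝ := (8 - ε) ^ k with hA
  have hn1' : (1 : ℝ) ≤ n := by exact_mod_cast hn1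
  have hnsq1 : (1 : ℝ) ≤ (n : ℝ) ^ 2 := by nlinarith
  have hA1 : 1 ≤ A := hnsq1.trans hn2
  -- `k` odd and `A > 0` force `8 - ε > 0`, hence `A ≤ (8 - ε')^k`
  have hbase : 0 < 8 - ε := (hkodd.pow_pos_iff).1 (lt_of_lt_of_le one_pos hA1)
  have hAle : A ≤ (8 - ε') ^ k := pow_le_pow_left₀ hbase.le (by linarith) k
  -- hosting: `R̃(T_k) ≤ n^ω ≤ A^{ω/2}`
  have hhostle := asymptoticRank_le_of_hosting hn1 hle
  have hω0 : 0 ≤ omega ℂ / 2 := by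
    have := omega_two_le (K := ℂ)
    positivity
  have hn0 : (0 : ℝ) ≤ n := Nat.cast_nonneg n
  have hnω : (n : ℝ) ^ omega ℂ = ((n : ℝ) ^ 2) ^ (omega ℂ / 2) := by
    rw [← Real.rpow_natCast (n : ℝ) 2, ← Real.rpow_mul hn0]
    congr 1
    push_cast
    ring
  have hpow : ((n : ℝ) ^ 2) ^ (omega ℂ / 2) ≤ A ^ (omega ℂ / 2) :=
    Real.rpow_le_rpow (by positivity) hn2 hω0
  -- the sandwich `A < A^{ω/2}`
  have hsand : A < A ^ (omega ℂ / 2) := by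
    calc A ≤ (8 - ε') ^ k := hAle
      _ < asymptoticRank (tripartitionTensor ℂ k) := hD
      _ ≤ (n : ℝ) ^ omega ℂ := hhostle
      _ = ((n : ℝ) ^ 2) ^ (omega ℂ / 2) := hnω
      _ ≤ A ^ (omega ℂ / 2) := hpow
  -- which is impossible when `ω ≤ 2`
  by_contra hω
  rw [not_lt] at hω
  have hexp : omega ℂ / 2 ≤ 1 := by linarith
  have hle1 : A ^ (omega ℂ / 2) ≤ A ^ (1 : ℝ) := Real.rpow_le_rpow_of_exponent_le hA1 hexp
  rw [Real.rpow_one] at hle1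
  exact absurd (hsand.trans_le hle1) (lt_irrefl A)

/-- **COMPOSITION `FidelityThesis_of` (= the split glue `fidelityThesis_of_subs` of the planner file
`FidelityWitnessesFidelityThesisSplit.lean`, to be landed by a prover as Theorems/…Split.lean):
`stub_tripartitionDarkness-statement → stub_matMulHostsTripartition-statement → FidelityThesis`.**  The two hypotheses are the child statements verbatim; the conclusion is the route
decl.  From `two_lt_omega_of_pieces` and the landed `omega_le_two_of_not_fidelityThesis` (Bini +
Alder–Strassen + cone closure). [folklore] -/
theorem FidelityThesis_of
    (hdark : ∀ ε : ℝ, 0 < ε → ε < 8 → ∃ k₀ : ℕ, ∀ k : ℕ, k₀ ≤ k →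
      ((8 : ℝ) - ε) ^ k < Literature.Computability.AlgebraicComplexity.asymptoticRank
        (Literature.Computability.AlgebraicComplexity.tripartitionTensor ℂ k))
    (hhost : ∃ ε : ℝ, 0 < ε ∧ ∃ k₀ : ℕ, ∀ k : ℕ, k₀ ≤ k → ∃ n : ℕ, 1 ≤ n ∧
      ((n : ℝ)) ^ 2 ≤ (8 - ε) ^ k ∧
      Literature.Computability.AlgebraicComplexity.AsympLe
        (fun x y : Literature.Computability.AlgebraicComplexity.TensorClass ℂ => x ≤ y)
        (Literature.Computability.AlgebraicComplexity.TensorClass.mk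
          (Literature.Computability.AlgebraicComplexity.tripartitionTensor ℂ k))
        (Literature.Computability.AlgebraicComplexity.TensorClass.mk
          (Literature.Computability.AlgebraicComplexity.matMulTensor ℂ n n n))) :
    FidelityThesis := by
  by_contra hX
  exact absurd (two_lt_omega_of_pieces hdark hhost) (not_lt.2 (omega_le_two_of_not_fidelityThesis hX))


/-! ## Second layer: four LEAF stubs and the two pieces DERIVED from them (sorry-free)

The pieces are themselves split once (two layers max): `X₁ ⟸ stub_tkBorderRate ∧ stub_tkBorderTensorises`
(a finite-k certificate family in BORDER RANK, and a structural tensorisation property of `T_k`'s border rank),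
`X₂ ⟸ stub_tripartitionGroupDesign ∧ stub_matMulDominatesDirectSums` (a Cohn–Umans-type group design for
`T_k` at rate `< 8`, and the matrix-multiplication-only spectral fact that `⟨n,n,n⟩` asymptotically dominates
every direct sum `⊕ᵢ ⟨dᵢ,dᵢ,dᵢ⟩` with `dᵢ ≤ n`, `Σ dᵢ² ≤ n²`).  Each leaf is a genuine statement of its own
kind; none mentions `ω`; none is its parent reworded. -/

/-- **LEAF 1a (`X₁` side): DARKNESS ALREADY AT THE FIRST POWER, IN BORDER RANK** — for every `ε ∈ (0,8)`,
eventually `R̲(T_k) > (8−ε)^k` (the tree's algebraic border rank).  Unconditionally `C(3k,k) ≤ R̲(T_k) ≤ R(T_k)`;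
`R̲(T_1) = R̲(cw_2) = 4 = 8/2` is maximal.  For `k ≤ 10` the target `(8−ε)^k` is INSIDE the cactus cap
`6·C(3k,k) − 4` of linear methods, so Koszul flattenings can in principle certify the first rungs
(`R̲(T_2) ∈ [15, 32]`, format 15). [cite: Pratt2024SCC, Cor. 1.12] -/
theorem stub_tkBorderRate :
    ∀ ε : ℝ, 0 < ε → ε < 8 → ∃ k₀ : ℕ, ∀ k : ℕ, k₀ ≤ k →
      ((8 : ℝ) - ε) ^ k <
        (Literature.Computability.AlgebraicComplexity.algBorderRank
          (Literature.Computability.AlgebraicComplexity.tripartitionTensor ℂ k) : ℝ) := by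
  sorry

/-- **LEAF 1b (`X₁` side): THE BORDER RANK OF `T_k` TENSORISES** — for every `ε ∈ (0,1)`, eventually in `k`,
the Kronecker powers satisfy `R̲(T_k^{⊠N}) ≥ (R̲(T_k)·(1−ε)^k)^N` for all large `N` (super-multiplicativity up
to rate; exact at `T_1`: `R̲(cw_2^{⊠2}) = 16 = 4²`, ConnerHuangLandsberg2020).  A consequence of `X₁` (given
`R̲(T_k) ≤ 8^k`), independent of LEAF 1a; false if ARC holds at `T_k`. [cite: Pratt2024SCC, Cor. 1.11] -/
theorem stub_tkBorderTensorises :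
    ∀ ε : ℝ, 0 < ε → ε < 1 → ∃ k₀ : ℕ, ∀ k : ℕ, k₀ ≤ k → ∃ N₀ : ℕ, ∀ N : ℕ, N₀ ≤ N →
      ((Literature.Computability.AlgebraicComplexity.algBorderRank
          (Literature.Computability.AlgebraicComplexity.tripartitionTensor ℂ k) : ℝ) * (1 - ε) ^ k) ^ N ≤
        (Literature.Computability.AlgebraicComplexity.algBorderRank
          (Literature.Computability.AlgebraicComplexity.kroneckerPow
            (Literature.Computability.AlgebraicComplexity.tripartitionTensor ℂ k) N) : ℝ) := by
  sorry

/-- **LEAF 2a (`X₂` side): A TRIPARTITION GROUP DESIGN BELOW RATE 8** — some `g < 8` and, for all large `k`,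
a finite group `G_k` with `|G_k| ≤ g^k` whose group-algebra tensor asymptotically hosts `T_k`:
`[T_k] ≲ [T_{ℂ[G_k]}]` (a tripartition-TPP realisation `T_k ≤ ℂ[G_k]` is the intended witness; Pratt's own
`R(T_k) ≤ 8^k/2` is the ABELIAN instance `ℤ₂^{3k−1}` of rate exactly `8`, and under `X₁` every witness of
rate `< 8` is nonabelian with exponentially large character degrees). [cite: CohnUmans2003, Thm. 2.3] -/
theorem stub_tripartitionGroupDesign :
    ∃ g : ℝ, 0 < g ∧ g < 8 ∧ ∃ k₀ : ℕ, ∀ k : ℕ, k₀ ≤ k →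
      ∃ (G : Type) (_ : Group G) (_ : Fintype G) (_ : DecidableEq G),
        (Fintype.card G : ℝ) ≤ g ^ k ∧
        Literature.Computability.AlgebraicComplexity.AsympLe
          (fun x y : Literature.Computability.AlgebraicComplexity.TensorClass ℂ => x ≤ y)
          (Literature.Computability.AlgebraicComplexity.TensorClass.mk
            (Literature.Computability.AlgebraicComplexity.tripartitionTensor ℂ k))
          (Literature.Computability.AlgebraicComplexity.TensorClass.mk
            (Literature.Computability.AlgebraicComplexity.groupTensor ℂ G)) := by
  sorry

/-- **LEAF 2b (`X₂` side, matrix multiplication only): `⟨n,n,n⟩` ASYMPTOTICALLY DOMINATES SMALL DIRECT SUMS** —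
if `dᵢ ≤ n` for all `i` and `Σᵢ dᵢ² ≤ n²` then `⊕ᵢ ⟨dᵢ,dᵢ,dᵢ⟩ ≲ ⟨n,n,n⟩` in Strassen's asymptotic preorder on
`TensorClass ℂ`.  TRUE and provable (L/XL): by the spectral theorem (`asympLe_iff_forall_spectralPoint`, tree)
it suffices that every spectral point reads `n ↦ n^a` on square matrix products with `a ≥ 2` (complete
multiplicativity + monotonicity give the power law; `a ≥ 2` is Strassen's `Q̃(⟨n,n,n⟩) = n²`, a Salem–Spencer
zeroing, Mathlib's Behrend), and then `Σ dᵢ^a ≤ n^{a−2} Σ dᵢ² ≤ n^a`. [cite: Strassen1988, Thm. 3.8] -/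
theorem stub_matMulDominatesDirectSums :
    ∀ (r : ℕ) (d : Fin r → ℕ) (n : ℕ), (∀ i, d i ≤ n) → ∑ i, d i ^ 2 ≤ n ^ 2 →
      Literature.Computability.AlgebraicComplexity.AsympLe
        (fun x y : Literature.Computability.AlgebraicComplexity.TensorClass ℂ => x ≤ y)
        (Literature.Computability.AlgebraicComplexity.TensorClass.mk
          (Literature.Computability.AlgebraicComplexity.matMulDirectSum ℂ d d d))
        (Literature.Computability.AlgebraicComplexity.TensorClass.mk
          (Literature.Computability.AlgebraicComplexity.matMulTensor ℂ n n n)) := by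
  sorry

/-! ### Derivation of `X₁` from LEAF 1a ∧ LEAF 1b -/

/-- Rate lemma: an eventual exponential lower bound on the ranks of Kronecker powers bounds the asymptotic
rank — if `c ≥ 0` and `c^N ≤ R(t^{⊠N})` for all `N ≥ N₀`, then `c ≤ R̃(t)` (sub-multiplicativity
`R(t^{⊠NM}) ≤ R(t^{⊠N})^M` moves every `N ≥ 1` past `N₀`; then `R̃ = inf_N R(t^{⊠N})^{1/N}`). [folklore] -/
theorem le_asymptoticRank_of_eventually_pow_le {ι κ μ : Type} [Fintype ι] [Fintype κ] [Fintype μ]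
    [DecidableEq ι] [DecidableEq κ] [DecidableEq μ] (t : ι → κ → μ → ℂ) {c : ℝ} (hc : 0 ≤ c) {N₀ : ℕ}
    (h : ∀ N : ℕ, N₀ ≤ N → c ^ N ≤ (tensorRank (kroneckerPow t N) : ℝ)) :
    c ≤ asymptoticRank t := by
  have hS := TensorClass.isStrassenPreorder ℂ
  -- every `N ≥ 1` : `c^N ≤ R(t^{⊠N})`
  have hall : ∀ N : ℕ, 1 ≤ N → c ^ N ≤ (tensorRank (kroneckerPow t N) : ℝ) := by
    intro N hN
    -- `M := N₀ + 1 ≥ 1`, `N·M ≥ N₀`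
    set M : ℕ := N₀ + 1 with hM
    have hNM : N₀ ≤ N * M := by
      have : N₀ ≤ N * N₀ := Nat.le_mul_of_pos_left N₀ hN
      calc N₀ ≤ N * N₀ := this
        _ ≤ N * M := Nat.mul_le_mul_left N (Nat.le_succ N₀)
    have h1 := h (N * M) hNM
    -- `R(t^{⊠NM}) ≤ R(t^{⊠N})^M` in `TensorClass`
    have h2 : tensorRank (kroneckerPow t (N * M)) ≤ tensorRank (kroneckerPow t N) ^ M := by
      have := hS.rankOf_pow_le ((TensorClass.mk t) ^ N) M
      rwa [← pow_mul, TensorClass.mk_pow, TensorClass.mk_pow, TensorClass.rankOf_mk,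
        TensorClass.rankOf_mk] at this
    have h3 : (c ^ N) ^ M ≤ ((tensorRank (kroneckerPow t N) : ℝ)) ^ M := by
      rw [← pow_mul]
      exact h1.trans (by exact_mod_cast h2)
    exact le_of_pow_le_pow_left₀ (Nat.succ_ne_zero N₀) (Nat.cast_nonneg _) h3
  -- `R̃(t) = ⨅_N R(t^{⊠(N+1)})^{1/(N+1)}`
  unfold asymptoticRank
  refine le_ciInf fun N => ?_
  have hN1 : (N + 1 : ℕ) ≠ 0 := Nat.succ_ne_zero N
  have hc' : c = (c ^ (N + 1)) ^ ((N : ℝ) + 1)⁻¹ := by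
    rw [show ((N : ℝ) + 1) = ((N + 1 : ℕ) : ℝ) by push_cast; ring, Real.pow_rpow_inv_natCast hc hN1]
  rw [hc']
  exact Real.rpow_le_rpow (pow_nonneg hc _) (hall (N + 1) (Nat.succ_le_succ (Nat.zero_le N)))
    (by positivity)

/-- **`X₁` FROM ITS LEAVES**: border-rank darkness at the first power (LEAF 1a) and tensorisation (LEAF 1b) give
`TripartitionDarkness` — for `ε₀ ∈ (0,8)` take `δ := ε₀/16`; eventually
`((8−δ)(1−δ))^{kN} ≤ (R̲(T_k)(1−δ)^k)^N ≤ R̲(T_k^{⊠N}) ≤ R(T_k^{⊠N})` for all large `N`, so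
`R̃(T_k) ≥ ((8−δ)(1−δ))^k ≥ (8 − 9δ)^k > (8−ε₀)^k`. [folklore] -/
theorem tripartitionDarkness_of_leaves
    (hrate : ∀ ε : ℝ, 0 < ε → ε < 8 → ∃ k₀ : ℕ, ∀ k : ℕ, k₀ ≤ k →
      ((8 : ℝ) - ε) ^ k < (algBorderRank (tripartitionTensor ℂ k) : ℝ))
    (htens : ∀ ε : ℝ, 0 < ε → ε < 1 → ∃ k₀ : ℕ, ∀ k : ℕ, k₀ ≤ k → ∃ N₀ : ℕ, ∀ N : ℕ, N₀ ≤ N →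
      ((algBorderRank (tripartitionTensor ℂ k) : ℝ) * (1 - ε) ^ k) ^ N ≤
        (algBorderRank (kroneckerPow (tripartitionTensor ℂ k) N) : ℝ)) :
    ∀ ε : ℝ, 0 < ε → ε < 8 → ∃ k₀ : ℕ, ∀ k : ℕ, k₀ ≤ k →
      ((8 : ℝ) - ε) ^ k < asymptoticRank (tripartitionTensor ℂ k) := by
  intro ε₀ hε₀ hε₀8
  set δ : ℝ := ε₀ / 16 with hδ
  have hδpos : 0 < δ := by positivity
  have hδ8 : δ < 8 := by rw [hδ]; linarith
  have hδ1 : δ < 1 := by rw [hδ]; linarith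
  obtain ⟨k₁, hk₁⟩ := hrate δ hδpos hδ8
  obtain ⟨k₂, hk₂⟩ := htens δ hδpos hδ1
  refine ⟨max k₁ k₂ + 1, fun k hk => ?_⟩
  have hk1 : k₁ ≤ k := by have := le_max_left k₁ k₂; omega
  have hk2 : k₂ ≤ k := by have := le_max_right k₁ k₂; omega
  have hkpos : 1 ≤ k := by omega
  have hR := hk₁ k hk1
  obtain ⟨N₀, hN₀⟩ := hk₂ k hk2
  -- the base `c := ((8 - δ)(1 - δ))^k`
  have h1δ : 0 < 1 - δ := by linarith
  have h8δ : 0 < 8 - δ := by linarith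
  set c : ℝ := ((8 - δ) * (1 - δ)) ^ k with hc
  have hcpos : 0 ≤ c := by positivity
  have hcle : c ≤ (algBorderRank (tripartitionTensor ℂ k) : ℝ) * (1 - δ) ^ k := by
    rw [hc, mul_pow]
    exact mul_le_mul_of_nonneg_right hR.le (by positivity)
  have hpow : ∀ N : ℕ, N₀ ≤ N → c ^ N ≤ (tensorRank (kroneckerPow (tripartitionTensor ℂ k) N) : ℝ) := by
    intro N hN
    calc c ^ N ≤ ((algBorderRank (tripartitionTensor ℂ k) : ℝ) * (1 - δ) ^ k) ^ N :=
          pow_le_pow_left₀ hcpos hcle N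
      _ ≤ (algBorderRank (kroneckerPow (tripartitionTensor ℂ k) N) : ℝ) := hN₀ N hN
      _ ≤ (tensorRank (kroneckerPow (tripartitionTensor ℂ k) N) : ℝ) := by
          exact_mod_cast algBorderRank_le_tensorRank _
  have hmain := le_asymptoticRank_of_eventually_pow_le (tripartitionTensor ℂ k) hcpos hpow
  -- `(8 - ε₀)^k < (8 - 9δ)^k ≤ c`
  have h89 : 8 - ε₀ < 8 - 9 * δ := by rw [hδ]; linarith
  have hbase : 8 - 9 * δ ≤ (8 - δ) * (1 - δ) := by nlinarith
  have hlt : ((8 : ℝ) - ε₀) ^ k < (8 - 9 * δ) ^ k :=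
    pow_lt_pow_left₀ h89 (by linarith) (by omega)
  have hle : (8 - 9 * δ) ^ k ≤ c := pow_le_pow_left₀ (by rw [hδ]; linarith) hbase k
  exact hlt.trans_le (hle.trans hmain)

/-! ### Derivation of `X₂` from LEAF 2a ∧ LEAF 2b -/

/-- Group algebras are asymptotically hosted by matrix multiplication of the square-root size: if `|G| ≤ n²`
then `[T_{ℂ[G]}] ≲ [⟨n,n,n⟩]` — Wedderburn (`exists_algEquiv_pi_matrix`: `ℂ[G] ≃ ∏ ℂ^{dᵢ×dᵢ}`, so
`T_{ℂ[G]} ≤ ⊕ᵢ ⟨dᵢ,dᵢ,dᵢ⟩` with `Σ dᵢ² = |G|`, hence `dᵢ ≤ n`) composed with LEAF 2b. [cite: CohnUmans2003, §1.3] -/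
theorem groupAlgebraHosting_of_dominance
    (hdom : ∀ (r : ℕ) (d : Fin r → ℕ) (n : ℕ), (∀ i, d i ≤ n) → ∑ i, d i ^ 2 ≤ n ^ 2 →
      AsympLe (fun x y : TensorClass ℂ => x ≤ y) (TensorClass.mk (matMulDirectSum ℂ d d d))
        (TensorClass.mk (matMulTensor ℂ n n n)))
    (G : Type) [Group G] [Fintype G] [DecidableEq G] (n : ℕ) (hG : Fintype.card G ≤ n ^ 2) :
    AsympLe (fun x y : TensorClass ℂ => x ≤ y) (TensorClass.mk (groupTensor ℂ G))
      (TensorClass.mk (matMulTensor ℂ n n n)) := by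
  have hS := TensorClass.isStrassenPreorder ℂ
  obtain ⟨r, d, hd, ⟨φ⟩⟩ := Literature.RepresentationTheory.FiniteGroups.exists_algEquiv_pi_matrix G
  -- `T_{ℂ[G]} ≤ ⊕ᵢ ⟨dᵢ,dᵢ,dᵢ⟩`
  have h1 : TensorRestrictsTo (matMulDirectSum ℂ d d d) (groupTensor ℂ G) := by
    rw [← groupTensor_eq_structureTensor, ← structureTensor_blockBasis_eq_matMulDirectSum]
    exact structureTensor_restrictsTo_of_algEquiv (MonoidAlgebra.basis G ℂ) (blockBasis ℂ d) φ
  have hle : TensorClass.mk (groupTensor ℂ G) ≤ TensorClass.mk (matMulDirectSum ℂ d d d) :=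
    TensorClass.mk_le_mk_iff.2 h1
  -- `Σ dᵢ² = |G| ≤ n²` and `dᵢ ≤ n`
  have hsum : ∑ i, d i ^ 2 = Nat.card G :=
    Literature.RepresentationTheory.FiniteGroups.sum_sq_blockDegrees_eq_card φ
  have hsum' : ∑ i, d i ^ 2 ≤ n ^ 2 := by
    rw [hsum, Nat.card_eq_fintype_card]; exact hG
  have hdi : ∀ i, d i ≤ n := by
    intro i
    have hi : d i ^ 2 ≤ ∑ j, d j ^ 2 :=
      Finset.single_le_sum (f := fun j => d j ^ 2) (fun j _ => Nat.zero_le _) (Finset.mem_univ i)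
    by_contra hlt
    rw [not_le] at hlt
    have : n ^ 2 < d i ^ 2 := Nat.pow_lt_pow_left hlt two_ne_zero
    omega
  exact hS.asympLe_trans (hS.asympLe_of_le hle) (hdom r d n hdi hsum')

/-- **`X₂` FROM ITS LEAVES**: the group design (LEAF 2a, rate `g < 8`) and dominance (LEAF 2b) give
`MatMulHostsTripartition` with `ε := (8 − g)/2`: host `ℂ[G_k]` by `⟨n,n,n⟩`, `n := ⌊√|G_k|⌋ + 1`, so
`n² ≤ 4|G_k| ≤ 4 g^k ≤ ((8+g)/2)^k` for all large `k`. [folklore] -/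
theorem matMulHostsTripartition_of_leaves
    (hdesign : ∃ g : ℝ, 0 < g ∧ g < 8 ∧ ∃ k₀ : ℕ, ∀ k : ℕ, k₀ ≤ k →
      ∃ (G : Type) (_ : Group G) (_ : Fintype G) (_ : DecidableEq G),
        (Fintype.card G : ℝ) ≤ g ^ k ∧
        AsympLe (fun x y : TensorClass ℂ => x ≤ y) (TensorClass.mk (tripartitionTensor ℂ k))
          (TensorClass.mk (groupTensor ℂ G)))
    (hdom : ∀ (r : ℕ) (d : Fin r → ℕ) (n : ℕ), (∀ i, d i ≤ n) → ∑ i, d i ^ 2 ≤ n ^ 2 →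
      AsympLe (fun x y : TensorClass ℂ => x ≤ y) (TensorClass.mk (matMulDirectSum ℂ d d d))
        (TensorClass.mk (matMulTensor ℂ n n n))) :
    ∃ ε : ℝ, 0 < ε ∧ ∃ k₀ : ℕ, ∀ k : ℕ, k₀ ≤ k → ∃ n : ℕ, 1 ≤ n ∧
      ((n : ℝ)) ^ 2 ≤ (8 - ε) ^ k ∧
      AsympLe (fun x y : TensorClass ℂ => x ≤ y) (TensorClass.mk (tripartitionTensor ℂ k))
        (TensorClass.mk (matMulTensor ℂ n n n)) := by
  have hS := TensorClass.isStrassenPreorder ℂ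
  obtain ⟨g, hg, hg8, k₀, hk₀⟩ := hdesign
  -- the slack: `4 g^k ≤ b^k` eventually, `b := (8 + g)/2 ∈ (g, 8)`
  set b : ℝ := (8 + g) / 2 with hb
  have hgb : g < b := by rw [hb]; linarith
  have hb8 : b < 8 := by rw [hb]; linarith
  have hratio : 1 < b / g := (one_lt_div hg).2 hgb
  obtain ⟨k₁, hk₁⟩ : ∃ k₁ : ℕ, ∀ k : ℕ, k₁ ≤ k → (4 : ℝ) ≤ (b / g) ^ k := by
    have ht := tendsto_pow_atTop_atTop_of_one_lt hratio
    exact Filter.eventually_atTop.1 (ht.eventually_ge_atTop 4)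
  refine ⟨8 - b, by linarith, max k₀ k₁, fun k hk => ?_⟩
  have hk0 : k₀ ≤ k := (le_max_left _ _).trans hk
  have hk1 : k₁ ≤ k := (le_max_right _ _).trans hk
  obtain ⟨G, _, _, _, hcard, hle⟩ := hk₀ k hk0
  -- `n := ⌊√|G|⌋ + 1`
  set m : ℕ := Fintype.card G with hm
  set n : ℕ := Nat.sqrt m + 1 with hn
  have hm1 : 1 ≤ m := Fintype.card_pos
  have hmn : m ≤ n ^ 2 := (Nat.lt_succ_sqrt' m).le
  have hn4 : n ^ 2 ≤ 4 * m := by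
    have h1 : Nat.sqrt m ^ 2 ≤ m := Nat.sqrt_le' m
    have h2 : Nat.sqrt m ≤ m := Nat.sqrt_le_self m
    rw [hn]
    nlinarith
  refine ⟨n, Nat.succ_le_succ (Nat.zero_le _), ?_, ?_⟩
  · -- `n² ≤ 4 m ≤ 4 g^k ≤ b^k = (8 - (8 - b))^k`
    rw [sub_sub_cancel]
    have h4 := hk₁ k hk1
    have hgk : 0 < g ^ k := pow_pos hg k
    calc ((n : ℝ)) ^ 2 = ((n ^ 2 : ℕ) : ℝ) := by push_cast; ring
      _ ≤ ((4 * m : ℕ) : ℝ) := by exact_mod_cast hn4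
      _ = 4 * (m : ℝ) := by push_cast; ring
      _ ≤ 4 * g ^ k := by rw [hm]; linarith
      _ ≤ (b / g) ^ k * g ^ k := by nlinarith
      _ = b ^ k := by rw [div_pow, div_mul_cancel₀ _ hgk.ne']
  · -- `[T_k] ≲ [ℂ[G]] ≲ [⟨n,n,n⟩]`
    exact hS.asympLe_trans hle (groupAlgebraHosting_of_dominance hdom G n hmn)

/-! ## Compositions concluding the crux BY NAME -/

/-- The line closes the crux modulo its four LEAF stubs (audit: concludes `FidelityThesis` BY NAME):
`FidelityThesis_of (X₁ from LEAF 1a ∧ 1b) (X₂ from LEAF 2a ∧ 2b)`. -/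
theorem crux_of_stubs : FidelityThesis :=
  FidelityThesis_of (tripartitionDarkness_of_leaves stub_tkBorderRate stub_tkBorderTensorises)
    (matMulHostsTripartition_of_leaves stub_tripartitionGroupDesign stub_matMulDominatesDirectSums)

/-- Alternative composition for a DIRECT proof of the upper piece: `X₁` from its leaves, `X₂` as the registered
stub `stub_matMulHostsTripartition` (so a prover who constructs the hosting by any other mechanism lands it
`--supports stmt-MatrixMultiplication-4956` against that stub; `X₁` is the item stmt-MatrixMultiplication-18398). -/
theorem crux_of_stubs' : FidelityThesis :=
  FidelityThesis_of (tripartitionDarkness_of_leaves stub_tkBorderRate stub_tkBorderTensorises)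
    stub_matMulHostsTripartition

/-! ## Documentation theorems (sorry-free) -/

/-- EVIDENCE for stub 1: with the tree's named fact `pratt2024_cor_1_11` and the Set Cover Conjecture as
hypotheses, darkness holds (literally `h hscc`). [cite: Pratt2024SCC, Cor. 1.11] -/
theorem darkness_of_setCoverConjecture (h : pratt2024_cor_1_11)
    (hscc : Literature.Computability.FineGrained.SetCoverConjecture) :
    ∀ ε : ℝ, 0 < ε → ε < 8 → ∃ k₀ : ℕ, ∀ k : ℕ, k₀ ≤ k →
      ((8 : ℝ) - ε) ^ k < Literature.Computability.AlgebraicComplexity.asymptoticRank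
        (Literature.Computability.AlgebraicComplexity.tripartitionTensor ℂ k) :=
  h hscc

/-- Stub 1 refutes the crux `TkMinimal` of route `TripartitionBridge` (its verbatim text): darkness at
`ε = 1` gives `7^k < R̃(T_k)` eventually, minimality at `δ = 1/4` gives `R̃(T_k) ≤ 7^k` cofinally. [folklore] -/
theorem not_tkMinimal_of_darkness
    (hdark : ∀ ε : ℝ, 0 < ε → ε < 8 → ∃ k₀ : ℕ, ∀ k : ℕ, k₀ ≤ k →
      ((8 : ℝ) - ε) ^ k < Literature.Computability.AlgebraicComplexity.asymptoticRank
        (Literature.Computability.AlgebraicComplexity.tripartitionTensor ℂ k)) :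
    ¬ (∀ δ : ℝ, 0 < δ → ∀ k₀ : ℕ, ∃ k : ℕ, k₀ ≤ k ∧
      Literature.Computability.AlgebraicComplexity.asymptoticRank
        (fun S T U : {A : Finset (Fin (3 * k)) // A.card = k} =>
          if Disjoint S.1 T.1 ∧ Disjoint S.1 U.1 ∧ Disjoint T.1 U.1 then (1 : ℂ) else 0) ≤
        ((27 : ℝ) / 4 + δ) ^ k) := by
  intro hmin
  obtain ⟨k₀, hk₀⟩ := hdark 1 one_pos (by norm_num)
  obtain ⟨k, hk, hle⟩ := hmin (1 / 4) (by norm_num) k₀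
  have h1 := hk₀ k hk
  rw [← tripartitionTensor_def] at hle
  have h74 : ((27 : ℝ) / 4 + 1 / 4) ^ k = ((8 : ℝ) - 1) ^ k := by norm_num
  rw [h74] at hle
  exact absurd (h1.trans_le hle) (lt_irrefl _)

/-- The proved floor under stub 1: `binom(3k,k) ≤ R̃(T_k)` (flattening; tree theorem). [cite: Pratt2024SCC, Prop. 2.1] -/
theorem choose_le_asymptoticRank_Tk (k : ℕ) :
    ((3 * k).choose k : ℝ) ≤ asymptoticRank (tripartitionTensor ℂ k) :=
  choose_le_asymptoticRank_tripartitionTensor ℂ k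

/-- QUANTITATIVE PAYOFF of the sandwich at fixed rates: if at some `k ≥ 1` one has `ρ^k < R̃(T_k)` (darkness
at rate `ρ`) and `[T_k] ≲ [⟨n,n,n⟩]` with `1 ≤ n`, `n² ≤ θ^k`, then `ρ < θ^{ω/2}`, i.e.
`ω ≥ 2·log ρ / log θ` — e.g. `θ = 27/4`, `ρ → 8` certify `ω ≥ 2.178`. [folklore] -/
theorem rate_lt_rpow_of_pieces_at {k n : ℕ} {ρ θ : ℝ} (hn : 1 ≤ n)
    (hdark : ρ ^ k < asymptoticRank (tripartitionTensor ℂ k))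
    (hsz : ((n : ℝ)) ^ 2 ≤ θ ^ k)
    (hle : AsympLe (fun x y : TensorClass ℂ => x ≤ y) (TensorClass.mk (tripartitionTensor ℂ k))
      (TensorClass.mk (matMulTensor ℂ n n n))) :
    ρ ^ k < (θ ^ k) ^ (omega ℂ / 2) := by
  have hhostle := asymptoticRank_le_of_hosting hn hle
  have hω0 : 0 ≤ omega ℂ / 2 := by
    have := omega_two_le (K := ℂ)
    positivity
  have hn0 : (0 : ℝ) ≤ n := Nat.cast_nonneg n
  have hnω : (n : ℝ) ^ omega ℂ = ((n : ℝ) ^ 2) ^ (omega ℂ / 2) := by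
    rw [← Real.rpow_natCast (n : ℝ) 2, ← Real.rpow_mul hn0]
    congr 1
    push_cast
    ring
  calc ρ ^ k < asymptoticRank (tripartitionTensor ℂ k) := hdark
    _ ≤ (n : ℝ) ^ omega ℂ := hhostle
    _ = ((n : ℝ) ^ 2) ^ (omega ℂ / 2) := hnω
    _ ≤ (θ ^ k) ^ (omega ℂ / 2) := Real.rpow_le_rpow (by positivity) hsz hω0

end Summit.MatrixMultiplication.MatrixMultiplication.Cruxes.FidelityThesis.SccDarkHost
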